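import Summits.HodgeConjecture.HodgeConjecture.Theorems.F0P3cStCharTSFibreRealise        -- ★ p851521 (LH4-p01 g5): `invariants_of_norm_one_root`, `isLocalNormPair_of_entries`, `nonsingInvUnit_mem_local_one`; brings ★ FILE A
import Summits.HodgeConjecture.HodgeConjecture.Theorems.F0P3cStCharTSDGFieldReg          -- ★ p851444 (F0P3a-p03): `isUnit_charpoly_discr_iff_isRegularElt`; brings ★ DG-FIELD
import Summits.HodgeConjecture.HodgeConjecture.Theorems.F0P3cStCharTSEllOpen             -- ★ `evalPlace_injective`, `evalPlace_surjective`, `evalPlace_conjLocal`, `isRoot_map_iff_of_injective`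
import HarnessLib

/-!
# F0 · P3c · line LH6 «StCharTS» — «MOVING-SECTION★» (brick (c) of S13b «UPR-LC», road (I)): along a continuously moving norm-one root `U(y)` of `charpoly y` there is a
# section `y ↦ s(y) ∈ H_v = U(Φ₂) × U(Φ₁)`, CONTINUOUS at `y₀`, with `s(y)` `G`-regular, `ι(s(y)) ↔ y` and `U(1)`-slot `U(y)` for `y` near `y₀` [Rogawski1990, §4.3 p. 43; §5.4 p. 78; §12.5 pp. 182–184]

Cell `pub/hodgecm-mathlib`, crux H413 = `stmt-HodgeConjecture-24833` (lane `--supports … --as helper`), route HCCMUnconditional; seat F0P3-p02 (g20); datum road of the (S-𝔇)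
organ `stub_EllipticPackage`; slice S13b «UPR-LC» (PLAN `F0/P3/F0P3-p02/g20/S13b-PLAN.v1.F0P3p02g20.md`), brick (c).  The section is the explicit representative of ★ FILE A
(`exists_mem_local_two_of_invariants`: `g = [[0, (σk)⁻¹], [k, tr y − U]]`, `det g = d = det y · σU`) with a chart `k ∈ {1 − d, δ(1 + d)}` FIXED AT `y₀` (so that `k` moves
continuously), and `(U)` in `U(Φ₁)`; matching by ★ FIBRE-REALISE `isLocalNormPair_of_entries`.  Continuity into `H_v ⊆ GL₂ × GL₁` is read on the matrices AND their inverses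
(`Units.isInducing_embedProduct`), both explicit.  §2 transports a moving root read at the place `w` (★ MOVING-ROOT ∕ NORM-ONE-PERSIST currency, `K = L_w`) back to
`R = ∏_{w′∣v} L_{w′}` along the homeomorphism `R ≃ L_w` (non-split `v`).
THEOREMS ONLY (no definition ∕ instance ∕ notation ∕ named fact ∕ `sorry`); ★-only imports.
HONEST LABEL: HC_CM is proved only modulo the 7 printed citations (2 remaining named inputs: hLiu418 = `stmt-HodgeConjecture-24832`, h413 = `stmt-HodgeConjecture-24833`)
until rung 0 closes; this file closes no organ, count-neutral.

* §0 `continuous_charpoly_discr`, `eventually_isRegularElt` (the regular set of `U(Φ₃)(L⁺_v)` is open);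
* §1 `continuousAt_localTwo_of_matrix`, `continuousAt_localOne_of_matrix` (continuity into `U(Φ_N)(L⁺_v)` from the matrix and its inverse), `continuousAt_matrix_two`, `continuousAt_matrix_one`;
* §2 `exists_continuous_rightInverse_evalPlace`, `isRoot_of_isRoot_map_evalPlace`, `conj_mul_eq_one_of_evalPlace`;
* §3 `exists_conj_eq_neg_isUnit` (an anti-invariant unit `δ`, `σδ = −δ`);
* §4 HEAD `exists_continuousAt_section`.

## References
* [Rogawski1990] J. D. Rogawski, *Automorphic Representations of Unitary Groups in Three Variables*, Ann. of Math. Stud. 123 (1990): §3.1 p. 19, §4.3 p. 43, §5.4 p. 78 (matched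
  classes `γ_H ↦ γ` and their `U(1)`-slots), §12.5 pp. 182–184 (`χ_ρ^G` near a regular point).
* [CasselsFrohlichANT1967] J. W. S. Cassels, A. Fröhlich (eds.), *Algebraic Number Theory* (1967), Ch. II §10 (`L ⊗ K_v = ∏ L_w`); Hilbert's Theorem 90.
-/

set_option autoImplicit false
-- the mandated namespace has the single-problem summit's repeated segment (`HodgeConjecture.HodgeConjecture`)
set_option linter.dupNamespace false

noncomputable section

open Polynomial Filter Topology
open NumberField IsDedekindDomain
open scoped Matrix MatrixGroups
open Literature.NumberTheory.Automorphic Literature.NumberTheory.Automorphic.UnitaryGroup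
open Literature.NumberTheory.Rogawski1990

namespace Summit.HodgeConjecture.HodgeConjecture.Cruxes.H413.F0P3cStCharTSMovingSection

variable (L : Type) [Field L] [NumberField L] [IsCMField L] (v : HeightOneSpectrum (𝓞 ↥(maximalRealSubfield L)))

/-! ## §0 The regular set is open -/

/-- **`g ↦ discr(charpoly g)` is continuous** on `U(Φ₃)(L⁺_v)` (a polynomial in the coefficients, Mathlib `discr_of_degree_eq_three`; ★ `continuous_charpoly_coeff`).
[cite: Rogawski1990, §3.1 p. 19] -/
theorem continuous_charpoly_discr :
    Continuous fun g : Gqs L v => (g.val : GL (Fin 3) (UnitaryGroup.LocalRing L v)).val.charpoly.discr := by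
  have hM : Continuous fun g : Gqs L v => ((g.val : GL (Fin 3) (UnitaryGroup.LocalRing L v)).val : Matrix (Fin 3) (Fin 3) (UnitaryGroup.LocalRing L v)) :=
    Units.continuous_val.comp continuous_subtype_val
  have hc : ∀ i : ℕ, Continuous fun g : Gqs L v => ((g.val : GL (Fin 3) (UnitaryGroup.LocalRing L v)).val.charpoly.coeff i) :=
    fun i => (Literature.LinearAlgebra.Matrix.continuous_charpoly_coeff i).comp hM
  have heq : (fun g : Gqs L v => (g.val : GL (Fin 3) (UnitaryGroup.LocalRing L v)).val.charpoly.discr) = fun g : Gqs L v =>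
      (g.val : GL (Fin 3) (UnitaryGroup.LocalRing L v)).val.charpoly.coeff 2 ^ 2 * (g.val : GL (Fin 3) (UnitaryGroup.LocalRing L v)).val.charpoly.coeff 1 ^ 2
        - 4 * (g.val : GL (Fin 3) (UnitaryGroup.LocalRing L v)).val.charpoly.coeff 3 * (g.val : GL (Fin 3) (UnitaryGroup.LocalRing L v)).val.charpoly.coeff 1 ^ 3
        - 4 * (g.val : GL (Fin 3) (UnitaryGroup.LocalRing L v)).val.charpoly.coeff 2 ^ 3 * (g.val : GL (Fin 3) (UnitaryGroup.LocalRing L v)).val.charpoly.coeff 0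
        - 27 * (g.val : GL (Fin 3) (UnitaryGroup.LocalRing L v)).val.charpoly.coeff 3 ^ 2 * (g.val : GL (Fin 3) (UnitaryGroup.LocalRing L v)).val.charpoly.coeff 0 ^ 2
        + 18 * (g.val : GL (Fin 3) (UnitaryGroup.LocalRing L v)).val.charpoly.coeff 3 * (g.val : GL (Fin 3) (UnitaryGroup.LocalRing L v)).val.charpoly.coeff 2 *
            (g.val : GL (Fin 3) (UnitaryGroup.LocalRing L v)).val.charpoly.coeff 1 * (g.val : GL (Fin 3) (UnitaryGroup.LocalRing L v)).val.charpoly.coeff 0 := by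
    funext g
    exact discr_of_degree_eq_three (by rw [Matrix.charpoly_degree_eq_dim]; rfl)
  rw [heq]
  fun_prop

/-- **The regular set of `U(Φ₃)(L⁺_v)` is open**: near a regular `y₀` every `y` is regular (`discr(charpoly y)` is a unit at `y₀`, units are open, ★ `isUnit_charpoly_discr_iff_isRegularElt`).
[cite: Rogawski1990, §3.1 p. 19] -/
theorem eventually_isRegularElt {y₀ : Gqs L v} (hy₀ : IsRegularElt (y₀.val : GL (Fin 3) (UnitaryGroup.LocalRing L v))) :
    ∀ᶠ y in 𝓝 y₀, IsRegularElt (y.val : GL (Fin 3) (UnitaryGroup.LocalRing L v)) := by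
  have h0 : IsUnit ((y₀.val : GL (Fin 3) (UnitaryGroup.LocalRing L v)).val.charpoly.discr) :=
    (F0P3cStCharTSDGFieldReg.isUnit_charpoly_discr_iff_isRegularElt L v y₀).2 hy₀
  have hmem := (continuous_charpoly_discr L v).continuousAt.preimage_mem_nhds (Units.isOpen.mem_nhds h0)
  filter_upwards [hmem] with y hy
  exact (F0P3cStCharTSDGFieldReg.isUnit_charpoly_discr_iff_isRegularElt L v y).1 hy

/-! ## §1 Continuity into `U(Φ_N)(L⁺_v) ⊆ GL_N(R)` from the matrix and its inverse -/

/-- Continuity at a point of a map into `U(Φ₂)(L⁺_v)` follows from continuity of the matrix and of the inverse matrix (`GL_N ↪ M_N × M_Nᵐᵒᵖ` is inducing). -/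
theorem continuousAt_localTwo_of_matrix {Y : Type*} [TopologicalSpace Y] {y₀ : Y}
    (s : Y → (UnitaryGroup.cmDatum L 2 (Matrix.of fun i j : Fin 2 => if i.val + j.val + 1 = 2 then (1 : L) else 0)).Local v)
    (h1 : ContinuousAt (fun y => ((s y).val.val : Matrix (Fin 2) (Fin 2) (UnitaryGroup.LocalRing L v))) y₀)
    (h2 : ContinuousAt (fun y => (((s y).val⁻¹).val : Matrix (Fin 2) (Fin 2) (UnitaryGroup.LocalRing L v))) y₀) :
    ContinuousAt s y₀ := by
  refine (Topology.IsInducing.subtypeVal.continuousAt_iff).2 ?_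
  refine (Units.isInducing_embedProduct.continuousAt_iff).2 ?_
  change ContinuousAt (fun y => (((s y).val.val : Matrix (Fin 2) (Fin 2) (UnitaryGroup.LocalRing L v)), MulOpposite.op (((s y).val⁻¹).val))) y₀
  exact h1.prodMk (MulOpposite.continuous_op.continuousAt.comp h2)

/-- The same for `U(Φ₁)(L⁺_v)`. -/
theorem continuousAt_localOne_of_matrix {Y : Type*} [TopologicalSpace Y] {y₀ : Y}
    (s : Y → (UnitaryGroup.cmDatum L 1 (Matrix.of fun i j : Fin 1 => if i.val + j.val + 1 = 1 then (1 : L) else 0)).Local v)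
    (h1 : ContinuousAt (fun y => ((s y).val.val : Matrix (Fin 1) (Fin 1) (UnitaryGroup.LocalRing L v))) y₀)
    (h2 : ContinuousAt (fun y => (((s y).val⁻¹).val : Matrix (Fin 1) (Fin 1) (UnitaryGroup.LocalRing L v))) y₀) :
    ContinuousAt s y₀ := by
  refine (Topology.IsInducing.subtypeVal.continuousAt_iff).2 ?_
  refine (Units.isInducing_embedProduct.continuousAt_iff).2 ?_
  change ContinuousAt (fun y => (((s y).val.val : Matrix (Fin 1) (Fin 1) (UnitaryGroup.LocalRing L v)), MulOpposite.op (((s y).val⁻¹).val))) y₀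
  exact h1.prodMk (MulOpposite.continuous_op.continuousAt.comp h2)

omit [IsCMField L] in
/-- A `2 × 2` matrix of functions continuous at `y₀` is continuous at `y₀`. -/
theorem continuousAt_matrix_two {Y : Type*} [TopologicalSpace Y] {y₀ : Y} {a b c d : Y → UnitaryGroup.LocalRing L v}
    (ha : ContinuousAt a y₀) (hb : ContinuousAt b y₀) (hc : ContinuousAt c y₀) (hd : ContinuousAt d y₀) :
    ContinuousAt (fun y => !![a y, b y; c y, d y]) y₀ := by
  refine continuousAt_pi.2 fun i => continuousAt_pi.2 fun j => ?_
  fin_cases i <;> fin_cases j <;> simpa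

omit [IsCMField L] in
/-- A `1 × 1` matrix of a function continuous at `y₀` is continuous at `y₀`. -/
theorem continuousAt_matrix_one {Y : Type*} [TopologicalSpace Y] {y₀ : Y} {a : Y → UnitaryGroup.LocalRing L v} (ha : ContinuousAt a y₀) :
    ContinuousAt (fun y => !![a y]) y₀ := by
  refine continuousAt_pi.2 fun i => continuousAt_pi.2 fun j => ?_
  fin_cases i; fin_cases j; simpa

/-! ## §2 Reading at the unique place `w ∣ v` and back -/

/-- **A continuous right inverse of the evaluation `R = ∏_{w′∣v} L_{w′} → L_w`** at a non-split `v` (there `R ≃ L_w` is a homeomorphism, Mathlib `Homeomorph.piUnique`).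
[cite: CasselsFrohlichANT1967, Ch. II §10] -/
theorem exists_continuous_rightInverse_evalPlace (w : PlacesOver L v) (hw : IsCMField.complexConj L • w.1 = w.1) :
    ∃ ψ : w.1.adicCompletion L → UnitaryGroup.LocalRing L v, Continuous ψ ∧
      ∀ a, Pi.evalRingHom (fun w' : PlacesOver L v => w'.1.adicCompletion L) w (ψ a) = a := by
  haveI : Algebra.IsQuadraticExtension ↥(maximalRealSubfield L) L := IsCMField.isQuadraticExtension L
  haveI : Subsingleton (PlacesOver L v) := PlacesOver.subsingleton_of_smul_eq (IsCMField.complexConj L) (IsCMField.complexConj_ne_one L) w hw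
  letI : Unique (PlacesOver L v) := ⟨⟨w⟩, fun w' => Subsingleton.elim w' w⟩
  refine ⟨(Homeomorph.piUnique fun w' : PlacesOver L v => w'.1.adicCompletion L).symm, (Homeomorph.piUnique _).symm.continuous, fun a => ?_⟩
  exact (Homeomorph.piUnique fun w' : PlacesOver L v => w'.1.adicCompletion L).apply_symm_apply a

/-- Roots read at `w` are roots in `R` (★ `isRoot_map_iff_of_injective`, ★ `evalPlace_injective`). [cite: Rogawski1990, §3.1 p. 19] -/
theorem isRoot_of_isRoot_map_evalPlace (w : PlacesOver L v) (hw : IsCMField.complexConj L • w.1 = w.1) (p : (UnitaryGroup.LocalRing L v)[X]) (x : UnitaryGroup.LocalRing L v)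
    (h : (p.map (Pi.evalRingHom (fun w' : PlacesOver L v => w'.1.adicCompletion L) w)).IsRoot (Pi.evalRingHom (fun w' : PlacesOver L v => w'.1.adicCompletion L) w x)) :
    p.IsRoot x :=
  (F0P3cStCharTSEllOpen.isRoot_map_iff_of_injective _ (F0P3cStCharTSEllOpen.evalPlace_injective L v w hw) p x).1 h

/-- Norm-one read at `w` is norm-one in `R`: `σ_w(x_w)·x_w = 1 ⇒ σ(x)·x = 1` (★ `evalPlace_conjLocal`, ★ `evalPlace_injective`). [cite: Rogawski1990, §1.9 p. 8] -/
theorem conj_mul_eq_one_of_evalPlace (w : PlacesOver L v) (hw : IsCMField.complexConj L • w.1 = w.1) (x : UnitaryGroup.LocalRing L v)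
    (h : galAdicCompletionMap (L := L) (IsCMField.complexConj L) hw (Pi.evalRingHom (fun w' : PlacesOver L v => w'.1.adicCompletion L) w x) *
      Pi.evalRingHom (fun w' : PlacesOver L v => w'.1.adicCompletion L) w x = 1) :
    conjLocal L (IsCMField.complexConj L) v x * x = 1 := by
  apply F0P3cStCharTSEllOpen.evalPlace_injective L v w hw
  rw [map_mul, map_one, F0P3cStCharTSEllOpen.evalPlace_conjLocal L v w hw x]
  exact h

/-! ## §3 An anti-invariant unit -/

/-- **There is a unit `δ ∈ R` with `σδ = −δ`** (`δ = e − c e` for any `e ∈ L` moved by `c`, diagonally embedded). [cite: Rogawski1990, §1.9 p. 8] -/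
theorem exists_conj_eq_neg_isUnit :
    ∃ δ : UnitaryGroup.LocalRing L v, conjLocal L (IsCMField.complexConj L) v δ = -δ ∧ IsUnit δ := by
  obtain ⟨e, he⟩ : ∃ e : L, IsCMField.complexConj L e ≠ e := by
    by_contra h
    exact IsCMField.complexConj_ne_one L (AlgEquiv.ext fun x => not_ne_iff.mp (not_exists.mp h x))
  set δL : L := e - IsCMField.complexConj L e with hδL
  have hδL0 : δL ≠ 0 := sub_ne_zero.2 (Ne.symm he)
  have hcδL : IsCMField.complexConj L δL = -δL := by
    rw [hδL, map_sub, IsCMField.complexConj_apply_apply, neg_sub]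
  refine ⟨algebraMap L (UnitaryGroup.LocalRing L v) δL, ?_, ?_⟩
  · rw [← algebraMap_localRing_conj L (IsCMField.complexConj L) v δL]
    change algebraMap L (UnitaryGroup.LocalRing L v) (IsCMField.complexConj L δL) = _
    rw [hcδL, map_neg]
  · refine isUnit_localRing_of_forall_apply_ne_zero fun w' => ?_
    rw [Pi.algebraMap_apply]
    exact (map_ne_zero_iff _ (RingHom.injective _)).2 hδL0

/-! ## §4 HEAD: the moving section -/

/-- **MOVING SECTION.**  Let `U : U(Φ₃)(L⁺_v) → R` be continuous at `y₀` and, for `y` near `y₀`, let `y` be regular with `U(y)` a NORM-ONE ROOT of `charpoly y` (`σU·U = 1`).  Then there is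
`s : U(Φ₃)(L⁺_v) → H_v = U(Φ₂) × U(Φ₁)`, CONTINUOUS AT `y₀`, such that for `y` near `y₀`: `s(y)` is `G`-regular, `ι(s(y)) ↔ y`, and its `U(1)`-slot is `U(y)`.  Construction:
`s(y) = ([[0, (σk)⁻¹], [k, tr y − U]], (U))` with `d = det y · σU`, chart `k = 1 − d` if `1 − d(y₀)` is a unit, else `k = δ(1 + d)` (`σδ = −δ`; then `d(y₀) = 1`, `1 + d(y₀) = 2`);
membership ★ FILE A `exists_mem_local_two_of_invariants`, matching ★ FIBRE-REALISE `isLocalNormPair_of_entries`; continuity via §1 on the explicit matrices and inverses.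
[cite: Rogawski1990, §4.3 p. 43; §5.4 p. 78; §12.5 pp. 182–184] -/
theorem exists_continuousAt_section (w : PlacesOver L v) (hw : IsCMField.complexConj L • w.1 = w.1) (y₀ : Gqs L v)
    (U : Gqs L v → UnitaryGroup.LocalRing L v) (hU : ContinuousAt U y₀)
    (hev : ∀ᶠ y in 𝓝 y₀, IsRegularElt (y.val : GL (Fin 3) (UnitaryGroup.LocalRing L v)) ∧
      ((y.val : GL (Fin 3) (UnitaryGroup.LocalRing L v)).val.charpoly).IsRoot (U y) ∧ conjLocal L (IsCMField.complexConj L) v (U y) * U y = 1) :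
    ∃ s : Gqs L v → (UnitaryGroup.cmDatum L 2 (Matrix.of fun i j : Fin 2 => if i.val + j.val + 1 = 2 then (1 : L) else 0)).Local v ×
        (UnitaryGroup.cmDatum L 1 (Matrix.of fun i j : Fin 1 => if i.val + j.val + 1 = 1 then (1 : L) else 0)).Local v,
      ContinuousAt s y₀ ∧ ∀ᶠ y in 𝓝 y₀, IsLocalGRegular L v (s y) ∧ IsLocalNormPair L (qsForm L) v (s y) y ∧ finGammaTwo L v (s y) = U y := by
  classical
  haveI : Algebra.IsQuadraticExtension ↥(maximalRealSubfield L) L := IsCMField.isQuadraticExtension L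
  haveI hsub : Subsingleton (PlacesOver L v) := PlacesOver.subsingleton_of_smul_eq (IsCMField.complexConj L) (IsCMField.complexConj_ne_one L) w hw
  set σ := conjLocal L (IsCMField.complexConj L) v with hσ
  have hσσ : ∀ x, σ (σ x) = x := fun x => conjLocal_conjLocal_cm L v x
  have hσc : Continuous σ := UnitaryGroup.continuous_conjLocal L (IsCMField.complexConj L) v
  -- the matrix of `y`, its determinant and trace
  have hM : Continuous fun y : Gqs L v => ((y.val : GL (Fin 3) (UnitaryGroup.LocalRing L v)).val : Matrix (Fin 3) (Fin 3) (UnitaryGroup.LocalRing L v)) :=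
    Units.continuous_val.comp continuous_subtype_val
  set d : Gqs L v → UnitaryGroup.LocalRing L v := fun y => (y.val : GL (Fin 3) (UnitaryGroup.LocalRing L v)).val.det * σ (U y) with hd
  set t : Gqs L v → UnitaryGroup.LocalRing L v := fun y => (y.val : GL (Fin 3) (UnitaryGroup.LocalRing L v)).val.trace - U y with ht
  have hdc : ContinuousAt d y₀ := ((continuous_id.matrix_det.comp hM).continuousAt).mul (hσc.continuousAt.comp hU)
  have htc : ContinuousAt t y₀ := ((continuous_id.matrix_trace.comp hM).continuousAt).sub hU
  -- the invariants along the moving root (★ FIBRE-REALISE)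
  have hinv : ∀ y : Gqs L v, ((y.val : GL (Fin 3) (UnitaryGroup.LocalRing L v)).val.charpoly).IsRoot (U y) → σ (U y) * U y = 1 →
      σ (d y) * d y = 1 ∧ σ (t y) * d y = t y := fun y hr h1 => by
    obtain ⟨h₁, h₂, -⟩ := F0P3cStCharTSFibreRealise.invariants_of_norm_one_root L v y hr h1
    exact ⟨h₁, h₂⟩
  -- units of `R`: read at the unique place
  have hunit : ∀ x : UnitaryGroup.LocalRing L v, x w ≠ 0 → IsUnit x := fun x hx =>
    isUnit_localRing_of_forall_apply_ne_zero fun w' => by rw [Subsingleton.elim w' w]; exact hx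
  -- THE CHART `k`: continuous at `y₀`, a unit at `y₀`, and `k = −d·σk` wherever `σd·d = 1`
  obtain ⟨k, hkc, hk0, hkrel⟩ : ∃ k : Gqs L v → UnitaryGroup.LocalRing L v, ContinuousAt k y₀ ∧ IsUnit (k y₀) ∧
      ∀ y, σ (d y) * d y = 1 → k y = -d y * σ (k y) := by
    by_cases h1 : IsUnit (1 - d y₀)
    · refine ⟨fun y => 1 - d y, continuousAt_const.sub hdc, h1, fun y hy => ?_⟩
      rw [map_sub, map_one]
      linear_combination (-1 : UnitaryGroup.LocalRing L v) * hy
    · obtain ⟨δ, hσδ, hδu⟩ := exists_conj_eq_neg_isUnit L v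
      refine ⟨fun y => δ * (1 + d y), continuousAt_const.mul (continuousAt_const.add hdc), ?_, fun y hy => ?_⟩
      · -- `1 − d(y₀)` is not a unit ⇒ `d(y₀)_w = 1` ⇒ `(δ(1 + d(y₀)))_w = 2 δ_w ≠ 0`
        have hdw : d y₀ w = 1 := by
          by_contra hne
          exact h1 (hunit _ (by rw [Pi.sub_apply, Pi.one_apply]; exact sub_ne_zero.2 (Ne.symm hne)))
        refine hunit _ ?_
        show (δ * (1 + d y₀)) w ≠ 0
        rw [Pi.mul_apply, Pi.add_apply, Pi.one_apply, hdw]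
        exact mul_ne_zero ((Pi.isUnit_iff.1 hδu) w).ne_zero (by norm_num)
      · rw [map_mul, map_add, map_one, hσδ]
        linear_combination (-δ) * hy
  -- `k` (hence `σk`) is a unit near `y₀`
  have hku : ∀ᶠ y in 𝓝 y₀, IsUnit (k y) := hkc.preimage_mem_nhds (Units.isOpen.mem_nhds hk0)
  -- THE SECTION, pointwise
  have hsec : ∀ y : Gqs L v, ∃ sy : (UnitaryGroup.cmDatum L 2 (Matrix.of fun i j : Fin 2 => if i.val + j.val + 1 = 2 then (1 : L) else 0)).Local v ×
        (UnitaryGroup.cmDatum L 1 (Matrix.of fun i j : Fin 1 => if i.val + j.val + 1 = 1 then (1 : L) else 0)).Local v,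
      (((y.val : GL (Fin 3) (UnitaryGroup.LocalRing L v)).val.charpoly).IsRoot (U y) ∧ σ (U y) * U y = 1 ∧ IsUnit (k y)) →
        (sy.1.val.val : Matrix (Fin 2) (Fin 2) (UnitaryGroup.LocalRing L v)) = !![0, Ring.inverse (σ (k y)); k y, t y] ∧
        ((sy.1.val⁻¹).val : Matrix (Fin 2) (Fin 2) (UnitaryGroup.LocalRing L v)) = !![σ (d y) * t y, -(σ (d y) * Ring.inverse (σ (k y))); -(σ (d y) * k y), 0] ∧
        (sy.2.val.val : Matrix (Fin 1) (Fin 1) (UnitaryGroup.LocalRing L v)) = !![U y] ∧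
        ((sy.2.val⁻¹).val : Matrix (Fin 1) (Fin 1) (UnitaryGroup.LocalRing L v)) = !![σ (U y)] := by
    intro y
    by_cases hc : ((y.val : GL (Fin 3) (UnitaryGroup.LocalRing L v)).val.charpoly).IsRoot (U y) ∧ σ (U y) * U y = 1 ∧ IsUnit (k y)
    · obtain ⟨hr, h1, hky⟩ := hc
      obtain ⟨hdd, htt⟩ := hinv y hr h1
      have hσku : IsUnit (σ (k y)) := hky.map σ
      obtain ⟨g, hgmem, hgval, hginv, -, -⟩ := exists_mem_local_two_of_invariants (t y) (d y) (k y) hdd htt (hkrel y hdd) hσku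
      have he : (↑(hσku.unit⁻¹) : UnitaryGroup.LocalRing L v) = Ring.inverse (σ (k y)) := by
        have h' : Ring.inverse ((hσku.unit : UnitaryGroup.LocalRing L v)) = ↑(hσku.unit⁻¹) := Ring.inverse_unit hσku.unit
        rw [hσku.unit_spec] at h'
        exact h'.symm
      have huu : U y * σ (U y) = 1 := by rw [mul_comm]; exact h1
      have hdet1 : IsUnit (!![U y] : Matrix (Fin 1) (Fin 1) (UnitaryGroup.LocalRing L v)).det := by
        rw [Matrix.det_fin_one_of]; exact isUnit_iff_exists_inv.2 ⟨σ (U y), huu⟩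
      refine ⟨(⟨g, hgmem⟩, ⟨Matrix.nonsingInvUnit (!![U y]) hdet1, F0P3cStCharTSFibreRealise.nonsingInvUnit_mem_local_one L v h1 hdet1⟩), fun _ => ⟨?_, ?_, ?_, ?_⟩⟩
      · rw [← he]; exact hgval
      · rw [← he]; exact hginv
      · rfl
      · change ((Matrix.nonsingInvUnit (!![U y]) hdet1)⁻¹ : (Matrix (Fin 1) (Fin 1) (UnitaryGroup.LocalRing L v))ˣ).val = !![σ (U y)]
        have hBA : (!![σ (U y)] : Matrix (Fin 1) (Fin 1) (UnitaryGroup.LocalRing L v)) * !![U y] = 1 := by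
          ext i j; fin_cases i; fin_cases j
          simp [Matrix.mul_apply, h1]
        exact Matrix.inv_eq_left_inv hBA
    · exact ⟨1, fun h => absurd h hc⟩
  choose s hs using hsec
  -- the good set
  have hgood : ∀ᶠ y in 𝓝 y₀, IsRegularElt (y.val : GL (Fin 3) (UnitaryGroup.LocalRing L v)) ∧
      ((y.val : GL (Fin 3) (UnitaryGroup.LocalRing L v)).val.charpoly).IsRoot (U y) ∧ σ (U y) * U y = 1 ∧ IsUnit (k y) := by
    filter_upwards [hev, hku] with y hy hy'
    exact ⟨hy.1, hy.2.1, hy.2.2, hy'⟩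
  refine ⟨s, ?_, ?_⟩
  · -- CONTINUITY AT `y₀`: on the good set the matrices and inverses are explicit and continuous at `y₀`
    have hσk : ContinuousAt (fun y => σ (k y)) y₀ := hσc.continuousAt.comp hkc
    have hE : ContinuousAt (fun y => Ring.inverse (σ (k y))) y₀ := by
      obtain ⟨u₀, hu₀⟩ := hk0.map σ
      have hRi : ContinuousAt Ring.inverse (σ (k y₀)) := by
        have := NormedRing.inverse_continuousAt u₀
        rwa [hu₀] at this
      exact ContinuousAt.comp (g := Ring.inverse) (f := fun y => σ (k y)) hRi hσk
    have hσd : ContinuousAt (fun y => σ (d y)) y₀ := hσc.continuousAt.comp hdc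
    have hσU : ContinuousAt (fun y => σ (U y)) y₀ := hσc.continuousAt.comp hU
    have h1v : ContinuousAt (fun y => ((s y).1.val.val : Matrix (Fin 2) (Fin 2) (UnitaryGroup.LocalRing L v))) y₀ := by
      refine (continuousAt_matrix_two L v (continuousAt_const : ContinuousAt (fun _ : Gqs L v => (0 : UnitaryGroup.LocalRing L v)) y₀) hE hkc htc).congr ?_
      filter_upwards [hgood] with y hy
      exact ((hs y ⟨hy.2.1, hy.2.2.1, hy.2.2.2⟩).1).symm
    have h1i : ContinuousAt (fun y => (((s y).1.val⁻¹).val : Matrix (Fin 2) (Fin 2) (UnitaryGroup.LocalRing L v))) y₀ := by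
      refine (continuousAt_matrix_two L v (hσd.mul htc) (hσd.mul hE).neg (hσd.mul hkc).neg
        (continuousAt_const : ContinuousAt (fun _ : Gqs L v => (0 : UnitaryGroup.LocalRing L v)) y₀)).congr ?_
      filter_upwards [hgood] with y hy
      exact ((hs y ⟨hy.2.1, hy.2.2.1, hy.2.2.2⟩).2.1).symm
    have h2v : ContinuousAt (fun y => ((s y).2.val.val : Matrix (Fin 1) (Fin 1) (UnitaryGroup.LocalRing L v))) y₀ := by
      refine (continuousAt_matrix_one L v hU).congr ?_
      filter_upwards [hgood] with y hy
      exact ((hs y ⟨hy.2.1, hy.2.2.1, hy.2.2.2⟩).2.2.1).symm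
    have h2i : ContinuousAt (fun y => (((s y).2.val⁻¹).val : Matrix (Fin 1) (Fin 1) (UnitaryGroup.LocalRing L v))) y₀ := by
      refine (continuousAt_matrix_one L v hσU).congr ?_
      filter_upwards [hgood] with y hy
      exact ((hs y ⟨hy.2.1, hy.2.2.1, hy.2.2.2⟩).2.2.2).symm
    exact (continuousAt_localTwo_of_matrix L v (fun y => (s y).1) h1v h1i).prodMk (continuousAt_localOne_of_matrix L v (fun y => (s y).2) h2v h2i)
  · -- MATCHING on the good set (★ `isLocalNormPair_of_entries`)
    filter_upwards [hgood] with y hy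
    obtain ⟨hreg, hr, h1, hky⟩ := hy
    obtain ⟨hs1, -, hs2, -⟩ := hs y ⟨hr, h1, hky⟩
    have hσku : IsUnit (σ (k y)) := hky.map σ
    have he : Ring.inverse (σ (k y)) * σ (k y) = 1 := Ring.inverse_mul_cancel _ hσku
    have hkk : k y = -((y.val : GL (Fin 3) (UnitaryGroup.LocalRing L v)).val.det * σ (U y)) * σ (k y) := hkrel y (hinv y hr h1).1
    have hs2' : ((s y).2.val : GL (Fin 1) (UnitaryGroup.LocalRing L v)).val 0 0 = U y := by rw [hs2]; rfl
    exact F0P3cStCharTSFibreRealise.isLocalNormPair_of_entries L v y hreg hr h1 he hkk (s y) hs1 hs2'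

end Summit.HodgeConjecture.HodgeConjecture.Cruxes.H413.F0P3cStCharTSMovingSection

end
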